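import Summits.Ventures.PercRepro.Parallel
import Summits.Ventures.PercRepro.Series

/-!
# PercRepro — WLOG two-terminal-reduced: the concavity lemma on reduced instances implies it everywhere (typer-2, gen 4)

`LEAD-C011-concavity.md` §10.15 («the Lean-able route is the induction on `|E|` via substitution for
two-terminal unmarked networks, so WLOG `G′` is two-terminal-reduced»): an instance `(G, p, g)` with
marks `a, b, c, d` has a REDUCIBLE PAIR if two live edges (`p_e ≠ 0`) away from `g` are parallel, or
form a series pair at an unmarked vertex; then `Parallel.lean` / `Series.lean` rewrite `Q⁺(Δ_g, Δ_g)`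
as the same quantity of an instance with one live edge fewer. Hence

* `liveEdges p`, `liveEdges_parWeight_ssubset`, `liveEdges_serWeight_ssubset`, `isProb_parWeight`,
  `isProb_serWeight`;
* `HasReduciblePair G p g a b c d`, **`EdgeQuadNonposReduced`** (the concavity lemma asked only of
  instances WITHOUT a reducible pair) and **`EdgeQuadNonpos_of_reduced : EdgeQuadNonposReduced →
  EdgeQuadNonpos`** (strong induction on the number of live edges, over all graphs on the same
  vertex and edge types), with `C011_of_EdgeQuadNonposReduced`, `C005_of_EdgeQuadNonposReduced`.
-/

namespace PercRepro

open Finset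

section Weights

variable {E : Type*} [DecidableEq E]

/-- The parallel substitution of a probability vector is a probability vector. -/
theorem isProb_parWeight {p : E → ℝ} (hp : IsProb p) (e₁ e₂ : E) : IsProb (parWeight p e₁ e₂) := by
  unfold parWeight
  refine (hp.update e₂ ⟨le_rfl, zero_le_one⟩).update e₁ ⟨?_, ?_⟩
  · have h1 := hp.nonneg e₁
    have h2 := hp.nonneg e₂
    have h3 := hp.le_one e₁
    have h4 := hp.le_one e₂
    nlinarith [mul_nonneg (sub_nonneg.mpr h3) (sub_nonneg.mpr h4)]
  · have h1 := hp.nonneg e₁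
    have h2 := hp.nonneg e₂
    have h3 := hp.le_one e₁
    have h4 := hp.le_one e₂
    nlinarith [mul_nonneg (sub_nonneg.mpr h3) (sub_nonneg.mpr h4)]

/-- The series substitution of a probability vector is a probability vector. -/
theorem isProb_serWeight {p : E → ℝ} (hp : IsProb p) (e₁ e₂ : E) : IsProb (serWeight p e₁ e₂) := by
  unfold serWeight
  refine (hp.update e₂ ⟨le_rfl, zero_le_one⟩).update e₁ ⟨?_, ?_⟩
  · exact mul_nonneg (hp.nonneg e₁) (hp.nonneg e₂)
  · exact mul_le_one₀ (hp.le_one e₁) (hp.nonneg e₂) (hp.le_one e₂)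

end Weights

section Live

variable {E : Type*} [Fintype E]

open Classical in
/-- The LIVE (non-deleted) edges of `p`. -/
noncomputable def liveEdges (p : E → ℝ) : Finset E := Finset.univ.filter fun e => p e ≠ 0

open Classical in
/-- Membership in the live edges. -/
theorem mem_liveEdges {p : E → ℝ} {e : E} : e ∈ liveEdges p ↔ p e ≠ 0 := by
  simp [liveEdges]

variable [DecidableEq E]

/-- The parallel substitution deletes exactly `e₂` from the live edges. -/
theorem liveEdges_parWeight_ssubset {p : E → ℝ} {e₁ e₂ : E} (hne : e₁ ≠ e₂)
    (h₁ : p e₁ ≠ 0) (h₂ : p e₂ ≠ 0) : liveEdges (parWeight p e₁ e₂) ⊂ liveEdges p := by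
  rw [Finset.ssubset_iff_of_subset]
  · refine ⟨e₂, mem_liveEdges.mpr h₂, ?_⟩
    rw [mem_liveEdges, parWeight, Function.update_of_ne hne.symm, Function.update_self]
    exact fun h => h rfl
  · intro e he
    rw [mem_liveEdges] at he ⊢
    by_cases hee : e = e₁
    · subst hee
      exact h₁
    by_cases hee' : e = e₂
    · subst hee'
      exact h₂
    · rwa [parWeight, Function.update_of_ne hee, Function.update_of_ne hee'] at he

/-- The series substitution deletes exactly `e₂` from the live edges. -/
theorem liveEdges_serWeight_ssubset {p : E → ℝ} {e₁ e₂ : E} (hne : e₁ ≠ e₂)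
    (h₁ : p e₁ ≠ 0) (h₂ : p e₂ ≠ 0) : liveEdges (serWeight p e₁ e₂) ⊂ liveEdges p := by
  rw [Finset.ssubset_iff_of_subset]
  · refine ⟨e₂, mem_liveEdges.mpr h₂, ?_⟩
    rw [mem_liveEdges, serWeight, Function.update_of_ne hne.symm, Function.update_self]
    exact fun h => h rfl
  · intro e he
    rw [mem_liveEdges] at he ⊢
    by_cases hee : e = e₁
    · subst hee
      exact h₁
    by_cases hee' : e = e₂
    · subst hee'
      exact h₂
    · rwa [serWeight, Function.update_of_ne hee, Function.update_of_ne hee'] at he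

end Live

/-! ### Reducible pairs and the WLOG theorem -/

/-- The instance `(G, p, g)` with marks `a, b, c, d` has a REDUCIBLE PAIR: two live edges away from
`g` that are parallel, or that form a series pair at an unmarked vertex. -/
def HasReduciblePair {V E : Type*} (G : MultiGraph V E) (p : E → ℝ) (g : E) (a b c d : V) : Prop :=
  (∃ e₁ e₂, e₁ ≠ e₂ ∧ G.Parallel e₁ e₂ ∧ p e₁ ≠ 0 ∧ p e₂ ≠ 0 ∧ g ≠ e₁ ∧ g ≠ e₂) ∨
    (∃ e₁ e₂ x y z, G.IsSeries e₁ e₂ x y z ∧ p e₁ ≠ 0 ∧ p e₂ ≠ 0 ∧ g ≠ e₁ ∧ g ≠ e₂ ∧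
      a ≠ x ∧ b ≠ x ∧ c ≠ x ∧ d ≠ x)

/-- **The concavity lemma for two-terminal-REDUCED instances only**: `Q⁺(Δ_g, Δ_g) ≤ 0` whenever the
instance has no reducible pair. -/
def EdgeQuadNonposReduced : Prop :=
  ∀ {V E : Type} [Fintype E] [DecidableEq E] (G : MultiGraph V E) (p : E → ℝ), IsProb p →
    ∀ (a b c d : V) (g : E), ¬ HasReduciblePair G p g a b c d → G.deltaQuad p g a b c d ≤ 0

/-- **WLOG two-terminal-reduced**: the concavity lemma on reduced instances gives it on every
instance (strong induction on the number of live edges through the two substitutions). -/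
theorem EdgeQuadNonpos_of_reduced (h : EdgeQuadNonposReduced) : EdgeQuadNonpos := by
  intro V E _ _ G p hp a b c d g
  suffices key : ∀ n : ℕ, ∀ (G : MultiGraph V E) (q : E → ℝ), IsProb q → (liveEdges q).card = n →
      G.deltaQuad q g a b c d ≤ 0 from key _ G p hp rfl
  intro n
  induction n using Nat.strong_induction_on with
  | _ n ih =>
    intro G q hq hcard
    by_cases hred : HasReduciblePair G q g a b c d
    · rcases hred with ⟨e₁, e₂, hne, hpar, h₁, h₂, hg₁, hg₂⟩ |
        ⟨e₁, e₂, x, y, z, hs, h₁, h₂, hg₁, hg₂, ha, hb, hc, hd⟩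
      · have hlt : (liveEdges (parWeight q e₁ e₂)).card < n := by
          rw [← hcard]
          exact Finset.card_lt_card (liveEdges_parWeight_ssubset hne h₁ h₂)
        rw [G.deltaQuad_parallel hne hpar q hg₁ hg₂]
        exact ih _ hlt G _ (isProb_parWeight hq e₁ e₂) rfl
      · have hlt : (liveEdges (serWeight q e₁ e₂)).card < n := by
          rw [← hcard]
          exact Finset.card_lt_card (liveEdges_serWeight_ssubset hs.ne h₁ h₂)
        rw [hs.deltaQuad q hg₁ hg₂ ha hb hc hd]
        exact ih _ hlt _ _ (isProb_serWeight hq e₁ e₂) rfl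
    · exact h G q hq a b c d g hred

/-- **C-005⁺ from the concavity lemma on reduced instances.** -/
theorem C011_of_EdgeQuadNonposReduced (h : EdgeQuadNonposReduced) : C011 :=
  C011_of_EdgeQuadNonpos (EdgeQuadNonpos_of_reduced h)

/-- **C-005 from the concavity lemma on reduced instances.** -/
theorem C005_of_EdgeQuadNonposReduced (h : EdgeQuadNonposReduced) : C005 :=
  C005_of_C011 (C011_of_EdgeQuadNonposReduced h)

end PercRepro
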